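import Summits.HubbardSuperconductivity.HubbardSuperconductivity.Theorems.TwistGapTgTwistCeiling
import Summits.HubbardSuperconductivity.HubbardSuperconductivity.Theorems.TwistGapTgCruxGlue
import Summits.HubbardSuperconductivity.HubbardSuperconductivity.Theorems.DeformationLadderDeformedRung
import Summits.HubbardSuperconductivity.HubbardSuperconductivity.Theorems.DeformationLadderLadderThesisFreePoint
import Summits.HubbardSuperconductivity.HubbardSuperconductivity.Theorems.DeformationLadderLowEnergyRigidityInheritance
import Summits.HubbardSuperconductivity.HubbardSuperconductivity.Theorems.DeformationLadderLowEnergyRigidityTelescopeDefs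
import Summits.HubbardSuperconductivity.HubbardSuperconductivity.Theorems.DeformationLadderLowEnergyRigidityCompressionGap

/-!
# Crux `LowEnergyRigidity` (stmt-HubbardSuperconductivity-1892) — STRATEGY CENSUS, typed part

Companion of `Cruxes/LowEnergyRigidity/STRATEGY-CENSUS.md` (crux-strategist seat
`planner-cstrat-stmt-HubbardSuperconductivity-1892-0`, 2026-08-16). This file only TYPES the
statements discussed in the census and certifies, from theorems already in the tree, the two
claims of the census that are theorems rather than judgements:

* `not_thermodynamicPenaltySlopeAt` — the STRENGTHENING S1 ("the extensive pair penalty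
  `γ·L²·Π_L` raises the sector ground energy at an extensive linear rate", i.e. the left
  thermodynamic slope `-e′(0⁻) > 0` of the concave energy density of the deformation family) is
  FALSE at every `(U, δ)`: an immediate corollary of the Lieb–Schultz–Mattis twist bound
  `penaltyGap_le_of_twists` (Theorems/TwistGapTgTwistCeiling). So no thermodynamic (energy-density)
  functional can carry the crux; the crux is an `O(1)`-total-energy statement and the `O(1)` window
  is sharp (S2 in the census, same lemma with `J → ∞`).
* `deformedWindowRigidity` — the TRANSFER T0: one step to the attractive side of the corner, for the
  deformed model `K_L(U,g) = H_L - (g/L²)·pFᴴpF` with `g > 0` and `U < U₀(g,δ)`, the window statement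
  holds in a form far STRONGER than the crux (every window `w`, not only `O(1)`), by the same
  chord + repulsion-sandwich + extensive-gap argument that proved `DeformedRung`
  (`extensiveGap_all`, `sectorEnergy_mono_coupling`, `sectorEnergy_le_add_coupling`). The mechanism is
  the EXTENSIVE rigidity supplied by the mean-field term itself; it degenerates exactly at `g = 0`
  (`a = (κ(g,δ) - U)/(2g)` needs `U < κ(g,δ) → 0`), which is the census's precise breaking point.

The remaining declarations are `def`s (no assertions): the uniform-in-`U` floor S3 (refuted by the
order-ceiling evidence `a ≤ 64√2·√U` on the item, not yet landed), and `#check`s recording that the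
decompositions D1–D3 of the census are ALREADY typed and glued in the tree by name.
-/

noncomputable section

namespace Summit.HubbardSuperconductivity.HubbardSuperconductivity.Cruxes.LowEnergyRigidity.StrategyCensus

set_option linter.dupNamespace false

open Matrix
open Literature.MathematicalPhysics.QuantumLattice Literature.Probability.LatticeModels
open Summit.HubbardSuperconductivity.HubbardSuperconductivity.Theses.DeformationLadder
open Summit.HubbardSuperconductivity.HubbardSuperconductivity.Theses.TwistGap
open Summit.HubbardSuperconductivity.HubbardSuperconductivity.Theorems
open Summit.HubbardSuperconductivity.HubbardSuperconductivity.Theorems.DeformationLadder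
open Summit.HubbardSuperconductivity.DeformationLadder.DeformedRung
open Summit.HubbardSuperconductivity.TwTipContinuation.Negative
open scoped ComplexOrder

/-- The d-wave pair intensity `P_L = pFᴴ pF` (so `Π_L = L⁻⁴ P_L`). -/
local notation "𝐏" L:max => ((pairField dWaveFormFactor L)ᴴ * pairField dWaveFormFactor L)

/-- The crux's sector `(N_L, S^z = 0)`, `N_L = 2⌊(1-δ)L²/2⌋`. -/
local notation "𝐊" L:max δ:max =>
  (szSector (Λ := FermionTorus 2 L) (2 * ⌊(1 - δ) * (L : ℝ) ^ 2 / 2⌋₊) 0)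

/-! ## Strengthen S1 — the thermodynamic (extensive) penalty slope, and its refutation -/

/-- **S1 (census `## Strengthen`, candidate S⁺₁): thermodynamic penalty slope at `(U, δ)`.** The
EXTENSIVE pair penalty `γ L² Π_L = (γ/L²) pFᴴpF` (the deformation family at coupling
`g = -γ < 0`; in the tree's `s/L⁴` normalisation `s = γ L²`) raises the sector ground energy at an
extensive linear rate: `c γ L² ≤ minE(H_L + (γ/L²) pFᴴpF) − minE(H_L)` for all large even `L`. By
Griffiths' lemma this would give LRO `≥ c` for EVERY ground-state sequence and for every state
within `o(L²)` of the ground energy — far more than the crux. It is false at every `(U, δ)`: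
`not_thermodynamicPenaltySlopeAt`. [folklore] -/
def ThermodynamicPenaltySlopeAt (U δ : ℝ) : Prop :=
  ∃ c : ℝ, 0 < c ∧ ∃ γ : ℝ, 0 < γ ∧ ∃ L₀ : ℕ, ∀ (L : ℕ) [NeZero L], L₀ ≤ L → Even L →
    c * γ * (L : ℝ) ^ 2 ≤
      (hubbardTorus 2 L 1 U + ((γ * (L : ℝ) ^ 2 / (L : ℝ) ^ 4 : ℝ) : ℂ) • 𝐏 L).minEnergyOn (𝐊 L δ) -
        (hubbardTorus 2 L 1 U).minEnergyOn (𝐊 L δ)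

/-- **S1 is false at every `(U, δ)`** (census certificate). With `J := ⌈32/c⌉ + 1` charge twists
the Lieb–Schultz–Mattis bound `penaltyGap_le_of_twists` gives
`minE(H + (s/L⁴)P) − minE(H) ≤ 8π²J² + 16 s/J` for every `s ≥ 0`; at `s = γL²` the right side is
`8π²J² + (16/J) γ L² ≤ 8π²J² + c γ L²/2 < c γ L²` once `L > 16π²J²/(cγ)`. Hence the left
thermodynamic slope of the deformation family vanishes identically, `e(g) = e(0)` for `g ≤ 0`, in
every model with a local `U(1)` charge — superconducting or not. Lieb–Schultz–Mattis (1961) App. B;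
this tree: `penaltyGap_le_of_twists`. [folklore] -/
theorem not_thermodynamicPenaltySlopeAt (U δ : ℝ) : ¬ ThermodynamicPenaltySlopeAt U δ := by
  rintro ⟨c, hc, γ, hγ, L₀, h⟩
  -- number of twists: `16 / J ≤ c / 2`
  set J : ℕ := ⌈32 / c⌉₊ + 1 with hJ
  have hJpos : 0 < J := Nat.succ_pos _
  have hJge : 32 / c ≤ (J : ℝ) := by
    have h1 : 32 / c ≤ (⌈32 / c⌉₊ : ℝ) := Nat.le_ceil _
    have h2 : ((⌈32 / c⌉₊ : ℕ) : ℝ) ≤ (J : ℝ) := by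
      rw [hJ]; push_cast; linarith
    exact h1.trans h2
  have hcJ : 32 ≤ c * (J : ℝ) := by
    have := mul_le_mul_of_nonneg_left hJge hc.le
    rwa [mul_div_cancel₀ _ hc.ne'] at this
  -- a large even side
  set M : ℕ := ⌈16 * Real.pi ^ 2 * (J : ℝ) ^ 2 / (c * γ)⌉₊ + 1 with hM
  set L : ℕ := 2 * (L₀ + J + M + 1) with hL
  haveI : NeZero L := ⟨by omega⟩
  have hL0 : L₀ ≤ L := by omega
  have hLeven : Even L := ⟨L₀ + J + M + 1, by omega⟩
  have h2J : 2 * J < L := by omega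
  have hML : M ≤ L := by omega
  have key := h L hL0 hLeven
  have ceil := penaltyGap_le_of_twists U δ (s := γ * (L : ℝ) ^ 2) (by positivity) L hJpos h2J
  -- `16 γ L² / J ≤ c γ L² / 2`
  have hJposR : (0 : ℝ) < (J : ℝ) := by exact_mod_cast hJpos
  have h16 : 16 * (γ * (L : ℝ) ^ 2) / (J : ℝ) ≤ c * γ * (L : ℝ) ^ 2 / 2 := by
    rw [div_le_iff₀ hJposR]
    have hγL : 0 ≤ γ * (L : ℝ) ^ 2 := by positivity
    nlinarith
  -- `8 π² J² < c γ L² / 2`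
  have hMgt : 16 * Real.pi ^ 2 * (J : ℝ) ^ 2 / (c * γ) < (M : ℝ) := by
    have h1 : 16 * Real.pi ^ 2 * (J : ℝ) ^ 2 / (c * γ) ≤ (⌈16 * Real.pi ^ 2 * (J : ℝ) ^ 2 / (c * γ)⌉₊ : ℝ) :=
      Nat.le_ceil _
    have h2 : ((⌈16 * Real.pi ^ 2 * (J : ℝ) ^ 2 / (c * γ)⌉₊ : ℕ) : ℝ) + 1 = (M : ℝ) := by
      rw [hM]; push_cast; ring
    linarith
  have hcγ : 0 < c * γ := mul_pos hc hγ
  have hMgt' : 16 * Real.pi ^ 2 * (J : ℝ) ^ 2 < (M : ℝ) * (c * γ) := by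
    rwa [div_lt_iff₀ hcγ] at hMgt
  have hMLR : (M : ℝ) ≤ (L : ℝ) := by exact_mod_cast hML
  have hL1 : (1 : ℝ) ≤ (L : ℝ) := by
    have : 1 ≤ L := by omega
    exact_mod_cast this
  have hLL : (L : ℝ) ≤ (L : ℝ) ^ 2 := by nlinarith
  have h8 : 8 * Real.pi ^ 2 * (J : ℝ) ^ 2 < c * γ * (L : ℝ) ^ 2 / 2 := by nlinarith
  linarith

/-! ## Strengthen S3 — a `U`-uniform order floor (typed only) -/

/-- **S3 (census `## Strengthen`, candidate S⁺₃): a rigidity floor uniform in weak coupling.** Some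
doping `δ` and ONE pair `(κ, a)` serve every `U ∈ (0, U₀)`. Refuted by the order ceiling attached as
evidence to the item (prover OCC, `DeformationLadderLowEnergyRigidityOrderCeiling.lean`, not yet
landed): every witness of the rigidity matrix has `a ≤ 64√2·√U`, so `a → 0` as `U → 0⁺`; consistent
with the Kohn–Luttinger scale `e^{-1/(αρ²U²)}` of the order parameter
(`Literature.Barriers.HubbardSuperconductivity.PerturbativeInvisibilityOfPairing`). Typed here so that
nobody files it. [folklore] -/
def UniformWeakCouplingFloor : Prop :=
  ∃ δ ∈ Set.Ioo (0 : ℝ) (1 / 2), ∃ U₀ : ℝ, 0 < U₀ ∧ ∃ κ : ℝ, 0 < κ ∧ ∃ a : ℝ, 0 < a ∧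
    ∀ U ∈ Set.Ioo (0 : ℝ) U₀, ∃ L₀ : ℕ, ∀ (L : ℕ) [NeZero L], L₀ ≤ L → Even L →
      ∀ φ : Fock (Orb (FermionTorus 2 L)), φ ∈ 𝐊 L δ → star φ ⬝ᵥ φ = 1 →
        (star φ ⬝ᵥ (hubbardTorus 2 L 1 U) *ᵥ φ).re ≤ (hubbardTorus 2 L 1 U).minEnergyOn (𝐊 L δ) + κ →
        a ≤ (expect (𝐏 L) φ).re / (L : ℝ) ^ 4

/-! ## Transfer T0 — the deformed sibling `g > 0` has the step, in extensive form -/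

/-- **T0 (census `## Transfer`): window rigidity of the deformed model.** For every `g > 0` and
`δ ∈ (0,1/2)` there is `U₀ > 0` such that for `U ∈ [0, U₀)` some `a > 0` bounds from below the d-wave
LRO density of EVERY unit sector vector within ANY fixed total energy `w` of the sector ground energy
of `K_L(U,g) = H_L − (g/L²) pFᴴpF`, for all large `L` (every parity). This is the exact analogue of the
crux one step to the attractive side of the corner `g = 0`, with the window even allowed to be any
constant (the proof tolerates `w = o(L²)`). [folklore] -/
def DeformedWindowRigidity : Prop :=
  ∀ g : ℝ, 0 < g → ∀ δ ∈ Set.Ioo (0 : ℝ) (1 / 2), ∃ U₀ : ℝ, 0 < U₀ ∧ ∀ U ∈ Set.Ico (0 : ℝ) U₀,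
    ∃ a : ℝ, 0 < a ∧ ∀ w : ℝ, ∃ L₀ : ℕ, ∀ (L : ℕ) [NeZero L], L₀ ≤ L →
      ∀ φ : Fock (Orb (FermionTorus 2 L)), φ ∈ 𝐊 L δ → star φ ⬝ᵥ φ = 1 →
        (expect (hubbardTorus 2 L 1 U - ((g / (L : ℝ) ^ 2 : ℝ) : ℂ) • 𝐏 L) φ).re ≤
          (hubbardTorus 2 L 1 U - ((g / (L : ℝ) ^ 2 : ℝ) : ℂ) • 𝐏 L).minEnergyOn (𝐊 L δ) + w →
        a ≤ (expect (𝐏 L) φ).re / (L : ℝ) ^ 4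

/-- **T0 holds** (census certificate; the route's own engine). With `κ = κ(g,δ)` the extensive gap of
the `U = 0` reduced d-wave BCS torus (`extensiveGap_all`: `κ L² ≤ E_L(0,0) − E_L(0,g)`), `U₀ := κ`
and `a := (κ − U)/(2g)`: for a unit window vector `φ` at coupling `g`,
`E_L(U,0) ≤ ⟨φ, H_L φ⟩ = ⟨φ, K_L(U,g) φ⟩ + (g/L²)⟨φ, Pφ⟩ ≤ E_L(U,g) + w + (g/L²)⟨φ,Pφ⟩`
(variational principle; `expect_seededH_re`), while the repulsion sandwich gives
`E_L(U,0) ≥ E_L(0,0)` and `E_L(U,g) ≤ E_L(0,g) + U L²`; hence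
`(g/L²)⟨φ,Pφ⟩ ≥ (κ − U) L² − w ≥ (κ − U) L²/2` once `2w ≤ (κ − U) L²`. The mean-field term converts
the order into EXTENSIVE energy, which is why no `O(1)` resolution is needed here — and why nothing
survives at `g = 0`. Kaplan–Horsch–von der Linden (1989); Bach–Lieb–Solovej (1994); this tree:
`extensiveGap_all`, `sectorEnergy_mono_coupling`, `sectorEnergy_le_add_coupling`. [folklore] -/
theorem deformedWindowRigidity : DeformedWindowRigidity := by
  intro g hg δ hδ
  obtain ⟨κ, hκ, L₀, hgap⟩ := extensiveGap_all δ hδ g hg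
  refine ⟨κ, hκ, fun U hU => ?_⟩
  have hκU : 0 < κ - U := sub_pos.2 hU.2
  refine ⟨(κ - U) / (2 * g), by positivity, fun w => ⟨max L₀ (⌈2 * w / (κ - U)⌉₊ + 1), ?_⟩⟩
  intro L _ hL φ hφK hφ1 hE
  have hL0 : L₀ ≤ L := le_trans (le_max_left _ _) hL
  have hL1 : ⌈2 * w / (κ - U)⌉₊ + 1 ≤ L := le_trans (le_max_right _ _) hL
  -- `2 w ≤ (κ - U) L²`
  have hwL : 2 * w ≤ (κ - U) * (L : ℝ) ^ 2 := by
    have h1 : 2 * w / (κ - U) ≤ (⌈2 * w / (κ - U)⌉₊ : ℝ) := Nat.le_ceil _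
    have h2 : ((⌈2 * w / (κ - U)⌉₊ + 1 : ℕ) : ℝ) ≤ (L : ℝ) := by exact_mod_cast hL1
    push_cast at h2
    have h3 : 2 * w / (κ - U) ≤ (L : ℝ) := by linarith
    rw [div_le_iff₀ hκU] at h3
    have hL1' : (1 : ℝ) ≤ (L : ℝ) := by linarith [Nat.cast_nonneg (α := ℝ) ⌈2 * w / (κ - U)⌉₊]
    have hLL : (L : ℝ) ≤ (L : ℝ) ^ 2 := by nlinarith
    have h4 : (L : ℝ) * (κ - U) ≤ (L : ℝ) ^ 2 * (κ - U) := mul_le_mul_of_nonneg_right hLL hκU.le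
    linarith
  -- the sector is one of the `(2n, 0)` sectors with `n ≤ |Λ_L|`
  have hφne : φ ≠ 0 := by
    intro h0
    rw [h0, dotProduct_zero] at hφ1
    exact zero_ne_one hφ1
  have hn := le_card_of_mem_szSector L hφK hφne
  -- variational principle at coupling `0`, read through the seed identity
  obtain ⟨-, hb0⟩ := seeded_sector_groundState U 0 L hn
  have v0 := hb0 φ hφK hφ1
  have r0 := expect_seededH_re U g L 0 φ
  -- repulsion sandwich and the extensive `U = 0` gap
  have hmono := sectorEnergy_mono_coupling L 0 hU.1 hn
  have hle := sectorEnergy_le_add_coupling L g hU.1 hn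
  have hg0 := hgap L hL0
  rw [seededH_zero, seededH_zero] at hmono
  rw [seededH_zero] at v0 r0
  -- assemble: `(g/L²)·re⟨φ,Pφ⟩ ≥ (κ - U) L² - w ≥ (κ - U) L² / 2`
  have hLpos : (0 : ℝ) < (L : ℝ) := by exact_mod_cast Nat.pos_of_ne_zero (NeZero.ne L)
  have hL2 : (0 : ℝ) < (L : ℝ) ^ 2 := by positivity
  have hL4 : (0 : ℝ) < (L : ℝ) ^ 4 := by positivity
  have key : (κ - U) * (L : ℝ) ^ 2 / 2 ≤ g / (L : ℝ) ^ 2 * (expect (𝐏 L) φ).re := by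
    have : (0 - g) / (L : ℝ) ^ 2 * (expect (𝐏 L) φ).re = -(g / (L : ℝ) ^ 2 * (expect (𝐏 L) φ).re) := by
      ring
    linarith
  have key2 : (κ - U) * (L : ℝ) ^ 4 / 2 ≤ g * (expect (𝐏 L) φ).re := by
    have h1 := mul_le_mul_of_nonneg_right key hL2.le
    have e1 : g / (L : ℝ) ^ 2 * (expect (𝐏 L) φ).re * (L : ℝ) ^ 2 = g * (expect (𝐏 L) φ).re := by
      field_simp
    have e2 : (κ - U) * (L : ℝ) ^ 2 / 2 * (L : ℝ) ^ 2 = (κ - U) * (L : ℝ) ^ 4 / 2 := by ring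
    linarith
  rw [div_le_div_iff₀ (by positivity) hL4]
  nlinarith

/-! ## Decomposition D1–D3 — already typed and glued in the tree (recorded by name) -/

-- D1 (route TwistGap, stmt-1509 ∧ stmt-1510 ⇒ crux): stiffness × condensation, glue proved.
#check @Summit.HubbardSuperconductivity.HubbardSuperconductivity.Theorems.TwistGap.lowEnergyRigidity_of_tgCruxes
-- D2 (inheritance cut, idea condensation-gap-inheritance): thermodynamic condensation gap × mesoscopic
-- rigidity, composition proved.
#check @Summit.HubbardSuperconductivity.HubbardSuperconductivity.Theorems.LowEnergyRigidity.lowEnergyRigidity_of_condensationGap_of_mesoRigidity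
-- D3 (Poincaré telescope, idea poincare-telescope): Josephson inequality × coherence floor — inputs
-- typed and landed (composition attached as evidence, not yet landed).
#check @Summit.HubbardSuperconductivity.HubbardSuperconductivity.Theorems.LowEnergyRigidity.Telescope.JosephsonInequalityAt
#check @Summit.HubbardSuperconductivity.HubbardSuperconductivity.Theorems.LowEnergyRigidity.Telescope.CoherenceFloorAt
-- D4 (heavy-condensate fibration): the crux ⟺ a compression gap — a reformulation, not a split.
#check @Summit.HubbardSuperconductivity.HubbardSuperconductivity.Theorems.hcf_compressionGap_iff_lowEnergyRigidity
-- Negation handle already in the tree: the rigidity matrix is false at the free point `U = 0`.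
#check @Summit.HubbardSuperconductivity.HubbardSuperconductivity.Theorems.DeformationLadder.not_lowEnergyRigidityMatrix_at_free_point
-- The in-tree equivalences fixing the class of the crux.
#check @Summit.HubbardSuperconductivity.HubbardSuperconductivity.Theorems.DeformationLadder.lowEnergyRigidity_iff_tgThesis
#check @Summit.HubbardSuperconductivity.HubbardSuperconductivity.Theorems.DeformationLadder.ladderThesis_iff_lowEnergyRigidity

end Summit.HubbardSuperconductivity.HubbardSuperconductivity.Cruxes.LowEnergyRigidity.StrategyCensus
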